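import Summits.QuantumFields.YangMills.Theorems.FluctuationComparisonRegPrIntLS2BetaRelativeLadderVarTwoSquare
import HarnessLib

/-!
# S2β · (LIFT-V) §3 — THE FACTORISATION `η = Ad_{δ_U⁻¹}(R)·ε` OF THE RELATIVE CHORD THROUGH THE LIFTS, AND ITS PAIR LETTER
# `dist1 (η′·η⁻¹) ≤ dist1 (R′·R⁻¹) + 2·dist1 R·dist1 (δ′·δ⁻¹) + dist1 ε′ + dist1 ε` (any `GaugeGroup`, exact group algebra; UV3-NODE §102.9's architecture
# for the `V`-row of LIFT-LADDER″ — `T₂₂ = L⁻²` from the relative lift alone, the tree-trivial factor `ε` carrying sources only)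

Cell `ym3-torus` (rung R3 = continuum `SU(2)` Yang–Mills on the three-torus — NOT d = 4, NOT infinite volume, NOT a mass gap, NOT Clay).
Width seat «width 21» `ym3-torus-px21` (gen 24); `--kind proof --supports stmt-QuantumFields-20520 --as helper`, count-neutral, DEFINITION-FREE
(0 `def`, 0 `instance`, 0 `notation`, 0 `sorry`, default heartbeats); generic `P : Params`, ANY `GaugeGroup G`.

WHY (UV3-NODE §102.9, px21 g24: with the lane's Whitney hat lift the exact abelian LP gives `T₂₂·L² = 1.000` in EVERY pair class, mirrors included — kit
j344666–j344670; the architecture that proves it).  For the two towers at one level let `A_U, A_W` be the LIFTS of the coarser fields (defined on every fine bond),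
`U, W` the fine fields.  Bondwise put `δ_U := A_U⁻¹·U` (`= 1` on tree-comb bonds by (T4)), `R := A_U⁻¹·A_W` (the RELATIVE LIFT, px12 ✓p829341∕✓p829498),
`W̃ := A_W·δ_U` (`= W` on tree-comb bonds by (T4) for the `W`-tower), `ε := W̃⁻¹·W`.  Then EXACTLY `η := U⁻¹·W = Ad_{δ_U⁻¹}(R)·ε` (§1), and for two bonds
(§2–§3) `dist1 (η′·η⁻¹) ≤ dist1 (R′·R⁻¹) + 2·dist1 R·dist1 (δ′_U·δ_U⁻¹) + dist1 ε′ + dist1 ε`: the `V → V` coefficient of the `V`-row is the relative lift's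
(`dist1 (R′R⁻¹) ≤ L⁻²·V_{t−1}`-type, constant ONE, EVERY adjacent pair — ✓p829498 `…_of_support`), the conjugation costs `θ_abs·M∕L` (`T₂₁`), and `ε` is
TREE-TRIVIAL so px5 ✓`…TopLadderIntraBlock.dist1_chord_le_of_intraBlock` (two fields agreeing on the block's tree-comb bonds) bounds it by SOURCES only.
* §1 ★★ `eta_factorisation` (group level) ∕ `eta_factorisation_field` (bondwise for `GaugeField`s): `u⁻¹·w = ((a_U⁻¹u)⁻¹·(a_U⁻¹a_W)·(a_U⁻¹u)) · ((a_W·(a_U⁻¹u))⁻¹·w)`.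
* §2 ★ `dist1_conjFactor_pair_le` — `C := δ⁻¹Rδ`, `C′ := δ′⁻¹R′δ′`: `dist1 (C′·C⁻¹) ≤ dist1 (R′·R⁻¹) + 2·dist1 R·dist1 (δ′·δ⁻¹)` under the standard `hcomm`
  (`C′C⁻¹ = Ad_{δ′⁻¹}(R′·g·R⁻¹·g⁻¹)`, `g = δ′δ⁻¹`).
* §3 ★★★ `dist1_eta_pair_le` — the pair letter above; `dist1_eta_pair_le_field` — the same read on two bonds `b, b′` of the four fields `A_U A_W U W`.

HONEST SCOPE.  Group algebra; nothing of Bałaban's analysis is asserted or proved; the lift letters (✓p829498), the tree agreement (T4), px5's ladder lemma, the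
aggregation over READ′ and the (SCT′₂) budget are NOT here; (SCT′₁₂₃)∕COMB-ROW′∕NC-ROW′∕(TOP-LAD′)∕(ST′)'s discharge∕LOC∕D-GUARD∕GAP♯∘ (`stub_uniformFibreGapOrbit`,
registry untouched, 0∕5), S2β, crux 20520 and `YM3TorusSU2` are NOT proved; no registered stub is closed; rung R3 = SU(2) YM₃ on T³ — NOT d = 4, NOT infinite volume,
NOT a mass gap, NOT Clay; the Yang–Mills mass gap is NOT proved.
References: T. Bałaban, CMP **99** (1985) 75–102 [Balaban1985RegularSpaces] ((1.29) p.81 — the regular spaces bound the field and its covariant derivatives; (1.19) p.79);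
CMP **98** (1985) 17–51 [Balaban1985Averaging] ((9)–(10) p.19, bookkeeping); CMP **122** (1989) 355–392 [Balaban1989LargeFieldII] (p.382).
-/

set_option autoImplicit false

namespace Summit.QuantumFields.YangMills.Theorems.FluctuationComparisonRegPrIntLS2BetaRelativeLiftFactorisation

open Literature.MathematicalPhysics.QuantumFieldTheory.Balaban1983to89

variable {P : Params} {j : ℕ} {G : Type*} [GaugeGroup G]

/-! ## §1 The factorisation -/

/-- ★★ **`η = Ad_{δ_U⁻¹}(R)·ε`** at the group level: with `δ := a_U⁻¹u`, `R := a_U⁻¹a_W`, `W̃ := a_W·δ`, `ε := W̃⁻¹w`,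
`u⁻¹w = (δ⁻¹·R·δ)·ε`. [folklore] -/
theorem eta_factorisation (aU aW u w : G) :
    u⁻¹ * w = ((aU⁻¹ * u)⁻¹ * (aU⁻¹ * aW) * (aU⁻¹ * u)) * ((aW * (aU⁻¹ * u))⁻¹ * w) := by
  group

/-- The same bondwise for four fields (the lifts `A_U, A_W` and the fine fields `U, W`). [folklore] -/
theorem eta_factorisation_field (AU AW U W : GaugeField P j G) (b : PBond P j) :
    (U b)⁻¹ * W b = (((AU b)⁻¹ * U b)⁻¹ * ((AU b)⁻¹ * AW b) * ((AU b)⁻¹ * U b)) * ((AW b * ((AU b)⁻¹ * U b))⁻¹ * W b) :=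
  eta_factorisation (AU b) (AW b) (U b) (W b)

/-- On a bond where BOTH towers sit on their lifts (`U b = A_U b`, `W b = A_W b` — a tree-comb bond by (T4)) the factor `ε` is `1`. [folklore] -/
theorem eps_eq_one_of_tree (aU aW u w : G) (hu : u = aU) (hw : w = aW) : (aW * (aU⁻¹ * u))⁻¹ * w = 1 := by
  subst hu; subst hw; group

/-! ## §2 The conjugated factor across a pair -/

/-- ★ **PAIR DIFFERENCE OF THE CONJUGATED RELATIVE LIFT**: `C := δ⁻¹Rδ`, `C′ := δ′⁻¹R′δ′` ⟹
`dist1 (C′·C⁻¹) ≤ dist1 (R′·R⁻¹) + 2·dist1 R·dist1 (δ′·δ⁻¹)` (`C′C⁻¹ = Ad_{δ′⁻¹}(R′gR⁻¹g⁻¹)`, `g = δ′δ⁻¹`; `hcomm` on `[R, g]`). [folklore] -/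
theorem dist1_conjFactor_pair_le (hcomm : ∀ g h : G, dist1 (g * h * g⁻¹ * h⁻¹) ≤ 2 * dist1 g * dist1 h) (R R' δ δ' : G) :
    dist1 ((δ'⁻¹ * R' * δ') * (δ⁻¹ * R * δ)⁻¹) ≤ dist1 (R' * R⁻¹) + 2 * dist1 R * dist1 (δ' * δ⁻¹) := by
  have key : (δ'⁻¹ * R' * δ') * (δ⁻¹ * R * δ)⁻¹ = δ'⁻¹ * ((R' * R⁻¹) * (R * (δ' * δ⁻¹) * R⁻¹ * (δ' * δ⁻¹)⁻¹)) * δ'⁻¹⁻¹ := by group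
  rw [key, GaugeGroup.dist1_conj]
  have h1 := GaugeGroup.dist1_mul_le (R' * R⁻¹) (R * (δ' * δ⁻¹) * R⁻¹ * (δ' * δ⁻¹)⁻¹)
  have h2 := hcomm R (δ' * δ⁻¹)
  linarith

/-! ## §3 The pair letter -/

/-- ★★★ **THE PAIR LETTER OF THE FACTORISATION**: with `η = (δ⁻¹Rδ)·ε` and `η′ = (δ′⁻¹R′δ′)·ε′`,
`dist1 (η′·η⁻¹) ≤ dist1 (R′·R⁻¹) + 2·dist1 R·dist1 (δ′·δ⁻¹) + dist1 ε′ + dist1 ε` (`η′η⁻¹ = (C′C⁻¹)·Ad_C(ε′ε⁻¹)`). In the `V`-row: the first term is the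
relative lift's adjacent variation (`≤ L⁻²·V`), the second the θ-suppressed conjugation price, the last two the tree-trivial factor's chords (sources).
[cite: Balaban1985RegularSpaces, (1.29) p.81; Balaban1985Averaging, (9)-(10) p.19 (bookkeeping)] -/
theorem dist1_eta_pair_le (hcomm : ∀ g h : G, dist1 (g * h * g⁻¹ * h⁻¹) ≤ 2 * dist1 g * dist1 h) (R R' δ δ' ε ε' : G) :
    dist1 (((δ'⁻¹ * R' * δ') * ε') * ((δ⁻¹ * R * δ) * ε)⁻¹) ≤
      dist1 (R' * R⁻¹) + 2 * dist1 R * dist1 (δ' * δ⁻¹) + dist1 ε' + dist1 ε := by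
  have key : ((δ'⁻¹ * R' * δ') * ε') * ((δ⁻¹ * R * δ) * ε)⁻¹ =
      ((δ'⁻¹ * R' * δ') * (δ⁻¹ * R * δ)⁻¹) * ((δ⁻¹ * R * δ) * (ε' * ε⁻¹) * (δ⁻¹ * R * δ)⁻¹) := by group
  rw [key]
  have h1 := GaugeGroup.dist1_mul_le ((δ'⁻¹ * R' * δ') * (δ⁻¹ * R * δ)⁻¹) ((δ⁻¹ * R * δ) * (ε' * ε⁻¹) * (δ⁻¹ * R * δ)⁻¹)
  rw [GaugeGroup.dist1_conj] at h1
  have h2 := dist1_conjFactor_pair_le hcomm R R' δ δ'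
  have h3 := GaugeGroup.dist1_mul_le ε' ε⁻¹
  rw [GaugeGroup.dist1_inv] at h3
  linarith

/-- ★★ **THE PAIR LETTER ON TWO BONDS OF THE FOUR FIELDS** (`A_U, A_W` the lifts, `U, W` the fine fields; `b, b′` any two bonds — adjacent in the `V`-row):
`dist1 ((U b′)⁻¹W b′·((U b)⁻¹W b)⁻¹) ≤ dist1 (R b′·(R b)⁻¹) + 2·dist1 (R b)·dist1 (δ b′·(δ b)⁻¹) + dist1 (ε b′) + dist1 (ε b)` with `R = A_U⁻¹A_W`,
`δ = A_U⁻¹U`, `ε = (A_W·δ)⁻¹·W` spelled out. [cite: Balaban1985RegularSpaces, (1.29) p.81; Balaban1989LargeFieldII, p.382] -/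
theorem dist1_eta_pair_le_field (hcomm : ∀ g h : G, dist1 (g * h * g⁻¹ * h⁻¹) ≤ 2 * dist1 g * dist1 h)
    (AU AW U W : GaugeField P j G) (b b' : PBond P j) :
    dist1 (((U b')⁻¹ * W b') * ((U b)⁻¹ * W b)⁻¹) ≤
      dist1 (((AU b')⁻¹ * AW b') * ((AU b)⁻¹ * AW b)⁻¹) +
        2 * dist1 ((AU b)⁻¹ * AW b) * dist1 (((AU b')⁻¹ * U b') * ((AU b)⁻¹ * U b)⁻¹) +
        dist1 ((AW b' * ((AU b')⁻¹ * U b'))⁻¹ * W b') + dist1 ((AW b * ((AU b)⁻¹ * U b))⁻¹ * W b) := by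
  rw [eta_factorisation_field AU AW U W b, eta_factorisation_field AU AW U W b']
  have h := dist1_eta_pair_le hcomm ((AU b)⁻¹ * AW b) ((AU b')⁻¹ * AW b') ((AU b)⁻¹ * U b) ((AU b')⁻¹ * U b')
    ((AW b * ((AU b)⁻¹ * U b))⁻¹ * W b) ((AW b' * ((AU b')⁻¹ * U b'))⁻¹ * W b')
  simpa only [inv_inv] using h

/-! ## §4 (px12 g26 append, px21 g24 «APPEND welcome» 19:24:28Z) Single-bond sizes: the `Ad` price vanishes on class functions -/

/-- ★ **THE CHORD IS AT MOST THE RELATIVE LIFT PLUS THE DEFECT, IN `dist1`** (single bond; the conjugation by `δ = aU⁻¹u` is free because `dist1` is a class function):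
`dist1 (u⁻¹·w) ≤ dist1 (aU⁻¹·aW) + dist1 ((aW·(aU⁻¹·u))⁻¹·w)`. [cite: Balaban1985Averaging, (8) p.19] -/
theorem dist1_inv_mul_le_rel_add_defect (aU aW u w : G) :
    dist1 (u⁻¹ * w) ≤ dist1 (aU⁻¹ * aW) + dist1 ((aW * (aU⁻¹ * u))⁻¹ * w) := by
  rw [eta_factorisation aU aW u w]
  refine (GaugeGroup.dist1_mul_le _ _).trans ?_
  have hc : dist1 ((aU⁻¹ * u)⁻¹ * (aU⁻¹ * aW) * (aU⁻¹ * u)) = dist1 (aU⁻¹ * aW) := by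
    have h := GaugeGroup.dist1_conj (aU⁻¹ * aW) (aU⁻¹ * u)⁻¹
    rwa [inv_inv] at h
  rw [hc]

/-- ★ **THE RELATIVE LIFT IS AT MOST THE CHORD PLUS THE DEFECT** (the same identity read backwards): `dist1 (aU⁻¹·aW) ≤ dist1 (u⁻¹·w) + dist1 ((aW·(aU⁻¹·u))⁻¹·w)`.
[cite: Balaban1985Averaging, (8) p.19] -/
theorem dist1_rel_le_inv_mul_add_defect (aU aW u w : G) :
    dist1 (aU⁻¹ * aW) ≤ dist1 (u⁻¹ * w) + dist1 ((aW * (aU⁻¹ * u))⁻¹ * w) := by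
  have e : aU⁻¹ * aW = (aU⁻¹ * u) * ((u⁻¹ * w) * ((aW * (aU⁻¹ * u))⁻¹ * w)⁻¹) * (aU⁻¹ * u)⁻¹ := by group
  rw [e, GaugeGroup.dist1_conj]
  refine (GaugeGroup.dist1_mul_le _ _).trans ?_
  rw [GaugeGroup.dist1_inv]

end Summit.QuantumFields.YangMills.Theorems.FluctuationComparisonRegPrIntLS2BetaRelativeLiftFactorisation
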